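import Literature.Geometry.Riemannian.MetricFlowFDistanceSelf
import Literature.Geometry.Riemannian.MetricFlowFDistanceComm
import Literature.Geometry.Riemannian.MetricFlowFDistanceTriangle
import HarnessLib

/-!
# The `𝔽`-distance is an extended pseudometric on `H`-concentrated metric flow pairs (Bamler 2023,
# §5.2, Thm. 5.13 — the pseudometric part)

R. Bamler, *Compactness theory of the space of super Ricci flows*, Invent. Math. 233 (2023), §5.2,
Theorem (arXiv v1 Thm. 112): "`(𝔽^J_I, d^J_𝔽)` is a metric space if we allow infinite distances."
With the three landed ingredients — `fDist_self` (`d^J_𝔽(𝒳, 𝒳) = 0`, via the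
self-correspondence; needs the null set `I ∖ I'` measurable), `fDist_comm` (symmetry) and
`fDist_triangle` (triangle inequality, for `H`-concentrated flows: the tree's `FDistAdmissible`
integrates with a lower integral and the integrand is known to be Borel when the flows are
`H`-concentrated) — we package `d^J_𝔽` as a `PseudoEMetricSpace` structure on the type of
`H`-concentrated metric flow pairs over `I` with measurable exceptional set
(`MetricFlowPair.HConc I`, `MetricFlowPair.HConc.pseudoEMetricSpace J`). The remaining assertion
of the source's theorem, definiteness up to almost-always isometry (§5.3), is not addressed.

## References

* R. H. Bamler, *Compactness theory of the space of super Ricci flows*, Invent. Math. 233 (2023),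
  1121–1277, §5.2, Theorem (metric space) (arXiv v1 Thm. 112). [Bamler2023]
-/

noncomputable section

open Set MeasureTheory Filter TopologicalSpace Function
open scoped Topology ENNReal NNReal

namespace Literature.Geometry.Riemannian

universe u

namespace MetricFlowPair

variable (I : Set ℝ)

/-- **`H`-concentrated metric flow pairs over `I` with measurable exceptional set** — the pairs
for which all three pseudometric axioms of `d^J_𝔽` are available in the tree (all pairs arising
from Ricci flows and their `𝔽`-limits are of this kind: Bamler 2023, §7.1, Def. 7.1 (1)).
[cite: Bamler2023, §5.2, Theorem (metric space); §7.1, Def. 7.1] -/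
def HConc : Type (u + 1) :=
  {P : MetricFlowPair.{u} I // (∃ H, P.flow.IsHConcentrated H) ∧ MeasurableSet (I \ P.I')}

variable {I}

namespace HConc

/-- The underlying metric flow pair. [cite: Bamler2023, §5.2, Theorem (metric space)] -/
def toPair (P : HConc.{u} I) : MetricFlowPair.{u} I := P.1

/-- The flow of an element of `HConc I` is `H`-concentrated for some `H`.
[cite: Bamler2023, §7.1, Def. 7.1] -/
theorem isHConcentrated (P : HConc.{u} I) : ∃ H, P.toPair.flow.IsHConcentrated H := P.2.1

/-- The exceptional set `I ∖ I'` of an element of `HConc I` is measurable.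
[cite: Bamler2023, §5.1, Definition (metric flow pairs)] -/
theorem measurableSet_diff (P : HConc.{u} I) : MeasurableSet (I \ P.toPair.I') := P.2.2

variable (J : Set ℝ)

/-- **`d^J_𝔽` is an extended pseudometric on `H`-concentrated metric flow pairs fully defined
over `J`** (Bamler 2023, §5.2, Theorem: `(𝔽^J_I, d^J_𝔽)` is a metric space allowing infinite
distances — the pseudometric part). The hypothesis `hJ` records that every pair is fully defined
over `J` (needed for `d^J_𝔽(𝒳, 𝒳) = 0`); for `J = ∅` it is vacuous (`pseudoEMetricSpace`).
[cite: Bamler2023, §5.2, Theorem (metric space)] -/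
@[reducible] def pseudoEMetricSpaceOfFullyDefined
    (hJ : ∀ P : HConc.{u} I, P.toPair.FullyDefinedOver J) :
    PseudoEMetricSpace (HConc.{u} I) where
  edist P Q := fDist J P.toPair Q.toPair
  edist_self P := fDist_self P.toPair (hJ P) P.measurableSet_diff
  edist_comm P Q := fDist_comm J P.toPair Q.toPair
  edist_triangle P Q R :=
    fDist_triangle P.toPair Q.toPair R.toPair P.isHConcentrated Q.isHConcentrated R.isHConcentrated

/-- **`d_𝔽 = d^∅_𝔽` is an extended pseudometric on `H`-concentrated metric flow pairs over `I`.**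
[cite: Bamler2023, §5.2, Theorem (metric space)] -/
@[reducible] def pseudoEMetricSpace : PseudoEMetricSpace (HConc.{u} I) :=
  pseudoEMetricSpaceOfFullyDefined ∅ fun _ ↦ empty_subset _

/-- The extended distance of the structure is `d_𝔽`. [cite: Bamler2023, §5.2, Theorem (metric space)] -/
theorem pseudoEMetricSpace_edist (P Q : HConc.{u} I) :
    @edist _ (pseudoEMetricSpace (I := I)).toEDist P Q = fDist ∅ P.toPair Q.toPair := rfl

/-- **The triangle inequality of `d_𝔽` on `HConc I`, restated.**
[cite: Bamler2023, §5.2, Theorem (metric space)] -/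
theorem fDist_empty_triangle (P Q R : HConc.{u} I) :
    fDist ∅ P.toPair R.toPair ≤ fDist ∅ P.toPair Q.toPair + fDist ∅ Q.toPair R.toPair :=
  fDist_triangle P.toPair Q.toPair R.toPair P.isHConcentrated Q.isHConcentrated R.isHConcentrated

end HConc

end MetricFlowPair

end Literature.Geometry.Riemannian

end
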